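/-
COR-CM (cell pub-hodgecm2, stage 2 of the Hodge ladder) — count-neutral KERNEL COMBINATORICS «census ↔ tree dictionary, part 6: the
cover check in kernel-economic form» (seat prover-pub-hodgecm2-b23-g33-0, binder prover b23, gen 33; claim INT2-INTRINSIC addendum
DEG12-GENERATORS; sequel of `CorCM/FaceCensusOrbitTransport.lean`).  Pure list bookkeeping; theorems only; no definition, no named fact,
nothing asserted.  HONEST FRAMING (COORDINATOR RULING — HODGE FRAMING CORRECTION, 2026-08-21T11:55:35Z): `HC_CM` is NOT proved, here or
anywhere in the tree.  T5: n/a-class (no hypothesis binder beyond ordinary list data).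
-/
import Summits.HodgeConjecture.CorCM.FaceCensusOrbitTransport
import HarnessLib

/-!
# The cover side check of the orbit-equivariant transport, kernel-economic form

`FaceCensus.hgen_of_certOK_cover` (`CorCM/FaceCensusOrbitTransport.lean`) asks, as its hypothesis `hcover`, that the corner set of every
face of the model be (in normal form) the corner set of SOME Galois twist of SOME certified face — a triple `any`/`any` search that
recomputes `Γ.corners` of a twisted face at every step (`|faces| · |certs| · n` corner computations: 600 000 at degree 12).  Seat b30's
census files decide the same statement through a PRECOMPUTED list of the `n · |certs|` twisted corner sets (`genOrbitOK`, "kernel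
economy" note of `Census/DuodecicFaceSquaresCyclic.lean`).  This file proves, once and generically, that the precomputed-list form implies
the `hcover` form (`cover_of_contains`), so that per-type transport files at degree 12 and beyond can decide the cheap form by
`decide +kernel` and feed `hgen_of_certOK_cover` (`hgen_of_certOK_coverList`).
-/

noncomputable section

open NumberField NumberField.ComplexEmbedding

namespace Summit.HodgeConjecture.CorCM.FaceCensus

open Literature.AlgebraicGeometry.Motives (CMType)
open Summit.HodgeConjecture.CorCM.Census.FaceSquaresModel

variable {n : ℕ} (Γ : CMGaloisType n)

/-- **Cover check, list form ⟹ search form.**  If every face's normalised corner set is CONTAINED in the precomputed list of the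
normalised corner sets of all Galois twists of the certified faces, then the `hcover` hypothesis of `hgen_of_certOK_cover` holds.
[folklore] -/
theorem cover_of_contains (cs : List ((ℕ × ℕ × ℕ) × List ((ℕ × ℕ × ℕ) × ℤ) × List (ℕ × ℤ)))
    (h : (Γ.faces.all fun φ => (cs.flatMap fun c => (List.finRange n).map fun j =>
        normalize (Γ.corners (Γ.twist j c.1.1, Γ.twist j c.1.2.1, Γ.twist j c.1.2.2))).contains (normalize (Γ.corners φ))) = true) :
    (Γ.faces.all fun φ => cs.any fun c => (List.finRange n).any fun j =>
      normalize (Γ.corners φ) == normalize (Γ.corners (Γ.twist j c.1.1, Γ.twist j c.1.2.1, Γ.twist j c.1.2.2))) = true := by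
  rw [List.all_eq_true] at h ⊢
  intro φ hφ
  have hc := h φ hφ
  rw [List.contains_iff_mem, List.mem_flatMap] at hc
  obtain ⟨c, hcm, hj⟩ := hc
  rw [List.mem_map] at hj
  obtain ⟨j, hjm, hje⟩ := hj
  rw [List.any_eq_true]
  refine ⟨c, hcm, ?_⟩
  rw [List.any_eq_true]
  exact ⟨j, hjm, by rw [hje]; exact beq_self_eq_true _⟩

variable {F : Type} [Field F] [NumberField F] [IsGalois ℚ F] (e : GalT F ≃ Fin n)

/-- **`hgen_of_certOK_cover` with the cover check in list form** (all other hypotheses verbatim). [cite: Pohlmann1968, Thm. 1]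
[cite: Milne1999LefschetzClasses, Thm. 3.2] -/
theorem hgen_of_certOK_coverList (hmul : ∀ P Q : GalT F, e (P * Q) = Γ.mul (e P) (e Q)) (hconj : e conjT = Γ.conj)
    (reps : List (ℕ × ℕ × ℕ)) (cs : List ((ℕ × ℕ × ℕ) × List ((ℕ × ℕ × ℕ) × ℤ) × List (ℕ × ℤ)))
    (hcs : (cs.all fun c => Γ.faces.contains c.1 && Γ.certOK reps c.1 c.2.1 c.2.2) = true)
    (hcover : (Γ.faces.all fun φ => (cs.flatMap fun c => (List.finRange n).map fun j =>
        normalize (Γ.corners (Γ.twist j c.1.1, Γ.twist j c.1.2.1, Γ.twist j c.1.2.2))).contains (normalize (Γ.corners φ))) = true)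
    (horb : (cs.all fun c => c.2.1.all fun gi => reps.any fun r => (List.finRange n).any fun j =>
      [(Γ.twist j r.1, Γ.twist j r.2.1, Γ.twist j r.2.2),
        (flipAt (Γ.twist j r.2.1) (Γ.twist j r.1), Γ.twist j r.2.1, Γ.twist j r.2.2),
        (flipAt (Γ.twist j r.2.2) (Γ.twist j r.1), Γ.twist j r.2.1, Γ.twist j r.2.2),
        (flipAt (Γ.twist j r.2.2) (flipAt (Γ.twist j r.2.1) (Γ.twist j r.1)), Γ.twist j r.2.1, Γ.twist j r.2.2),
        (Γ.twist j r.1, Γ.twist j r.2.2, Γ.twist j r.2.1),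
        (flipAt (Γ.twist j r.2.1) (Γ.twist j r.1), Γ.twist j r.2.2, Γ.twist j r.2.1),
        (flipAt (Γ.twist j r.2.2) (Γ.twist j r.1), Γ.twist j r.2.2, Γ.twist j r.2.1),
        (flipAt (Γ.twist j r.2.2) (flipAt (Γ.twist j r.2.1) (Γ.twist j r.1)), Γ.twist j r.2.2, Γ.twist j r.2.1)].contains gi.1)
      = true)
    (hpc : (cs.all fun c => c.2.2.all fun pj => Γ.isCMType pj.1) = true)
    (σ₀ : F →+* ℂ) (𝒮 : Set (Face F))
    (hreps : ∀ r ∈ reps, ∃ R ∈ 𝒮, (r.1 < 2 ^ n ∧ ∀ i : Fin n, mem i r.1 = true ↔ e.symm i ∈ (pullType R.Φ σ₀).1) ∧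
      Γ.placeMask (e (translate σ₀ R.p)) = r.2.1 ∧ Γ.placeMask (e (translate σ₀ R.p')) = r.2.2)
    (f : Face F) :
    lefChar f.corner (fun _ => ({σ₀} : Finset (F →+* ℂ))) ∈ AddSubgroup.closure
      {a : Asym F | ∃ g ∈ 𝒮, ∃ σ : F →+* ℂ, a = lefChar g.corner (fun _ => ({σ} : Finset (F →+* ℂ)))} :=
  hgen_of_certOK_cover Γ e hmul hconj reps cs hcs (cover_of_contains Γ cs hcover) horb hpc σ₀ 𝒮 hreps f

end Summit.HodgeConjecture.CorCM.FaceCensus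

end
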